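import Literature.Topology.FourManifolds.FishtailParamsUpper
import HarnessLib

/-!
# The glue hypotheses of the concrete tube about Gompf's disc

Infrastructure for the explicit fishtail neighbourhood (R. Gompf, *More Cappell–Shaneson spheres
are standard*, Algebr. Geom. Topol. 10 (2010), proof of Thm 2.1 and Lemma 2.2; the named fact
`Literature.Topology.FourManifolds.gompf2010_framedTwist`). We verify `TubeDData.GlueHyp` for the
concrete tube data `fishTgen ε hε hε2 c ρb μ` of `FishtailParams.lean`: the ordering of the glue radii, the
seven junction agreements on the slabs of width `η`, and the local-diffeomorphism property of each
window, for admissible offsets in the thin annulus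
`Adm = {(ρ_b - E₁/c)² < a² + b² < ρ_b²}` and positions below `rmax = c (ρ_b + 2δ_c)`. Hence the
tube about Gompf's disc is a local diffeomorphism there (`isLocalDiffeomorphAt_tubeD`).

Everything is proved; no named facts.

## References

* R. E. Gompf, *More Cappell–Shaneson spheres are standard*, Algebr. Geom. Topol. 10 (2010)
  1665–1681, proof of Thm 2.1 and Lemma 2.2. [GompfAGT2010]
-/

noncomputable section

open scoped Real Topology ContDiff Manifold
open Set Filter Complex

namespace Literature.Topology.FourManifolds

local notation "𝔼 " n:arg => EuclideanSpace ℝ (Fin n)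

namespace FP

variable {ε : ℝ} (hε : 0 < ε) (hε2 : ε ≤ 1 / 2) {c ρb : ℝ} {μ : ℝ → ℝ}

/-! ### The admissible offsets and the maximal position -/

/-- **The admissible offsets**: the thin annulus `(ρ_b - E₁/c)² < a² + b² < ρ_b²`. [folklore] -/
def AdmP (ε : ℝ) (hε : 0 < ε) (hε2 : ε ≤ 1 / 2) : Set (ℝ × ℝ) :=
  {w | (rhoB ε hε hε2 - E1 / cL ε hε hε2) ^ 2 < w.1 ^ 2 + w.2 ^ 2 ∧ w.1 ^ 2 + w.2 ^ 2 < rhoB ε hε hε2 ^ 2}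

/-- The maximal position `rmax = c (ρ_b + 2 δ_c) = c ρ_b + 3/50`. [folklore] -/
def rmaxP (ε : ℝ) (hε : 0 < ε) (hε2 : ε ≤ 1 / 2) : ℝ := cL ε hε hε2 * (rhoB ε hε hε2 + 2 * delC ε hε hε2)

/-- `IsOpen (AdmP ε hε hε2)`. [folklore] -/
theorem isOpen_AdmP : IsOpen (AdmP ε hε hε2) := by
  have hc : Continuous fun w : ℝ × ℝ ↦ w.1 ^ 2 + w.2 ^ 2 := by fun_prop
  exact (isOpen_lt continuous_const hc).inter (isOpen_lt hc continuous_const)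

/-- `E₁ / c ≤ ρ_b / 3000` (since `c ρ_b ≥ 30`). [folklore] -/
theorem E1_div_cL_le : E1 / cL ε hε hε2 ≤ rhoB ε hε hε2 / 3000 := by
  have hc := cL_pos ε hε hε2
  have hcρ := cL_mul_rhoB ε hε hε2
  have h7 := s7_gt ε hε
  have ht := tan_beta7_ge (ε := ε)
  have hE := E1_le
  rw [div_le_iff₀ hc]
  nlinarith

/-- `rmaxP ε hε hε2 = cL ε hε hε2 * rhoB ε hε hε2 + 3 / 50`. [folklore] -/
theorem rmaxP_eq : rmaxP ε hε hε2 = cL ε hε hε2 * rhoB ε hε hε2 + 3 / 50 := by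
  have hc := (cL_pos ε hε hε2).ne'
  rw [rmaxP, delC]; field_simp; ring

variable {hε}

/-- Norm facts for admissible offsets: `‖w‖ < ρ_b ≤ ε/8`, `w ≠ 0`, `|a|, |b| < ρ_b`. [folklore] -/
theorem adm_bounds (hε2 : ε ≤ 1 / 2) {w : ℝ × ℝ} (hw : w ∈ AdmP ε hε hε2) :
    Real.sqrt (w.1 ^ 2 + w.2 ^ 2) < rhoB ε hε hε2 ∧ 0 < w.1 ^ 2 + w.2 ^ 2 ∧ |w.1| < rhoB ε hε hε2 ∧ |w.2| < rhoB ε hε hε2 ∧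
      rhoB ε hε hε2 - E1 / cL ε hε hε2 < Real.sqrt (w.1 ^ 2 + w.2 ^ 2) := by
  obtain ⟨h1, h2⟩ := hw
  have hρ := rhoB_pos hε hε2
  have hE := E1_div_cL_le (hε := hε) (hε2 := hε2)
  have hE0 : 0 < E1 / cL ε hε hε2 := div_pos E1_pos (cL_pos ε hε hε2)
  have hlo : 0 < rhoB ε hε hε2 - E1 / cL ε hε hε2 := by linarith
  have hs : Real.sqrt (w.1 ^ 2 + w.2 ^ 2) < rhoB ε hε hε2 := by
    rw [Real.sqrt_lt' hρ]; exact h2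
  have hpos : 0 < w.1 ^ 2 + w.2 ^ 2 := lt_of_le_of_lt (sq_nonneg _) h1
  refine ⟨hs, hpos, ?_, ?_, ?_⟩
  · rw [← Real.sqrt_sq_eq_abs]; exact lt_of_le_of_lt (Real.sqrt_le_sqrt (by nlinarith)) hs
  · rw [← Real.sqrt_sq_eq_abs]; exact lt_of_le_of_lt (Real.sqrt_le_sqrt (by nlinarith)) hs
  · rw [Real.lt_sqrt hlo.le]; exact h1

/-- The disc of admissible offsets (for the reference tube): `a² + b² < ρ_b²`. [folklore] -/
def DiscP (ε : ℝ) (hε : 0 < ε) (hε2 : ε ≤ 1 / 2) : Set (ℝ × ℝ) := {w | w.1 ^ 2 + w.2 ^ 2 < rhoB ε hε hε2 ^ 2}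

/-- `AdmP ε hε hε2 ⊆ DiscP ε hε hε2`. [folklore] -/
theorem AdmP_subset_DiscP : AdmP ε hε hε2 ⊆ DiscP ε hε hε2 := fun _ hw ↦ hw.2

/-- Norm facts on the disc: `‖w‖ < ρ_b`, `|a|, |b| < ρ_b`. [folklore] -/
theorem disc_bounds (hε2 : ε ≤ 1 / 2) {w : ℝ × ℝ} (hw : w ∈ DiscP ε hε hε2) :
    Real.sqrt (w.1 ^ 2 + w.2 ^ 2) < rhoB ε hε hε2 ∧ |w.1| < rhoB ε hε hε2 ∧ |w.2| < rhoB ε hε hε2 := by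
  have hρ := rhoB_pos hε hε2
  have hs : Real.sqrt (w.1 ^ 2 + w.2 ^ 2) < rhoB ε hε hε2 := by rw [Real.sqrt_lt' hρ]; exact hw
  refine ⟨hs, ?_, ?_⟩
  · rw [← Real.sqrt_sq_eq_abs]; exact lt_of_le_of_lt (Real.sqrt_le_sqrt (by nlinarith)) hs
  · rw [← Real.sqrt_sq_eq_abs]; exact lt_of_le_of_lt (Real.sqrt_le_sqrt (by nlinarith)) hs

/-! ### The junction agreements for the concrete data -/

section Agreements

include hε2 in
/-- `(fishTgen ε hε hε2 c ρb μ).winS q = (fishTgen ε hε hε2 c ρb μ).winA q`. [folklore] -/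
theorem ag1_holds {q : ℂ × ℝ × ℝ} (h : |‖q.1‖ - (fishTgen ε hε hε2 c ρb μ).s₁| < eta ε) :
    (fishTgen ε hε hε2 c ρb μ).winS q = (fishTgen ε hε hε2 c ρb μ).winA q := by
  have es₁ : (fishTgen ε hε hε2 c ρb μ).s₁ = 3 / 4 := rfl
  rw [es₁] at h
  obtain ⟨hn, hlt, hb⟩ := nfun_slab1 hε hε2 (c := c) (ρb := ρb) (μ := μ) h
  have hη := eta_lt hε hε2
  obtain ⟨h1, h2⟩ := abs_lt.1 h
  refine (fishTgen ε hε hε2 c ρb μ).agree₁ (by linarith) hb ?_ (by rw [hn]; exact hlt)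
  exact latF_of_le (ε := ε) (by linarith)

include hε2 in
/-- `(fishTgen ε hε hε2 c ρb μ).winA q = (fishTgen ε hε hε2 c ρb μ).winN q`. [folklore] -/
theorem ag2_holds {q : ℂ × ℝ × ℝ} (h : |‖q.1‖ - (fishTgen ε hε hε2 c ρb μ).s₂| < eta ε) :
    (fishTgen ε hε hε2 c ρb μ).winA q = (fishTgen ε hε hε2 c ρb μ).winN q := by
  have es₂ : (fishTgen ε hε hε2 c ρb μ).s₂ = s2 ε := rfl
  rw [es₂] at h
  obtain ⟨-, -, hnB⟩ := nfun_slab2 hε hε2 (c := c) (ρb := ρb) (μ := μ) h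
  obtain ⟨hP2, hn⟩ := Pfun_slab2 hε hε2 (c := c) (ρb := ρb) (μ := μ) h
  obtain ⟨htj1, htj2⟩ := capTj_bounds ε hε
  have hR := Rtwo_ge
  refine (fishTgen ε hε hε2 c ρb μ).agree₂ (by show nA ε ≤ nB ε; unfold nA nB; linarith) hnB hP2 ?_ ?_ hn
  · show capTj ε (nj ε) + 3 / 10 ≤ (fishTgen ε hε hε2 c ρb μ).Pfun ‖q.1‖; linarith
  · show 83 / 100 ≤ capTj ε (nj ε) + 3 / 10; linarith

include hε2 in
/-- `(fishTgen ε hε hε2 c ρb μ).winN q = (fishTgen ε hε hε2 c ρb μ).winU5 q`. [folklore] -/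
theorem ag3_holds {q : ℂ × ℝ × ℝ} (h : |‖q.1‖ - (fishTgen ε hε hε2 c ρb μ).s₃| < eta ε) :
    (fishTgen ε hε hε2 c ρb μ).winN q = (fishTgen ε hε hε2 c ρb μ).winU5 q := by
  have es₃ : (fishTgen ε hε hε2 c ρb μ).s₃ = s3 ε := rfl
  rw [es₃] at h
  have hη := eta_lt hε hε2
  have h' : |‖q.1‖ - s3 ε| < 1 / 10 := h.trans (by linarith)
  obtain ⟨hP, hP0, hP1, hb⟩ := Pfun_slab3 hε hε2 (c := c) (ρb := ρb) (μ := μ) h'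
  obtain ⟨hα1, hα2⟩ := alpha_slab3 h'
  obtain ⟨htj1, htj2⟩ := capTj_bounds ε hε
  have hρA : ρA = 1 / 20 := rfl
  set P := (fishTgen ε hε hε2 c ρb μ).Pfun ‖q.1‖ with hPdef
  have hPlo : 3 / 20 ≤ P := by rw [hP, show (3 : ℝ) / 20 = 3 * ρA by rw [hρA]; norm_num]; exact hP0
  have hPhi : P < 1 / 5 := by rw [hP, show (1 : ℝ) / 5 = 4 * ρA by rw [hρA]; norm_num]; exact hP1
  have hnormP : ‖(P : ℂ) * exp (arg q.1 * I)‖ = P := by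
    rw [norm_mul, Complex.norm_real, Complex.norm_exp_ofReal_mul_I, mul_one, Real.norm_eq_abs, abs_of_pos (by linarith)]
  have hd0 : capD0 ε (nj ε) = dCenter (capTj ε (nj ε)) := capD0_eq
  have hnd0 : ‖capD0 ε (nj ε)‖ = capTj ε (nj ε) := norm_capD0 (nj_sq_lt ε hε) (nj_neg ε hε)
  have hz_lo : capTj ε (nj ε) - P ≤ ‖capD0 ε (nj ε) + (P : ℂ) * exp (arg q.1 * I)‖ := by
    have := norm_sub_norm_le (capD0 ε (nj ε)) (-((P : ℂ) * exp (arg q.1 * I)))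
    rw [sub_neg_eq_add, norm_neg, hnd0, hnormP] at this
    linarith
  have hz_hi : ‖capD0 ε (nj ε) + (P : ℂ) * exp (arg q.1 * I)‖ ≤ capTj ε (nj ε) + P := by
    have := norm_add_le (capD0 ε (nj ε)) ((P : ℂ) * exp (arg q.1 * I))
    rwa [hnd0, hnormP] at this
  refine (fishTgen ε hε hε2 c ρb μ).agree₃ ρA_pos hb (show 0 < P by linarith) (show P ≤ Rone by unfold Rone; linarith)
    (show P < capTj ε (nj ε) by linarith) (show 4 / 5 ≤ ‖capD0 ε (nj ε) + (P : ℂ) * exp (arg q.1 * I)‖ by linarith)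
    (show ‖capD0 ε (nj ε) + (P : ℂ) * exp (arg q.1 * I)‖ < capTj ε (nj ε) + 3 / 10 by linarith) ?_
    (show angleUp (rzero ε) ‖q.1‖ ≤ 0 from hα2.le) (show -(π / 2) < angleUp (rzero ε) ‖q.1‖ by linarith [Real.pi_pos])
  -- the section is the polar angle about the puncture within distance `1/5`
  have hdist : ‖capD0 ε (nj ε) + (P : ℂ) * exp (arg q.1 * I) - dCenter (capTj ε (nj ε))‖ ≤ 1 / 5 := by
    rw [← hd0, add_sub_cancel_left, hnormP]; exact hPhi.le
  show sigmaCapC (capTj ε (nj ε)) (1 / 200) (1 / 5) (1 / 4) (3 / 10) (capD0 ε (nj ε) + (P : ℂ) * exp (arg q.1 * I)) =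
    unitC ((P : ℂ) * exp (arg q.1 * I))
  rw [sigmaCapC_of_norm_le (by norm_num) (by norm_num) hdist, ← hd0, add_sub_cancel_left]

include hε2 in
/-- `(fishTgen ε hε hε2 c ρb μ).winU5 q = (fishTgen ε hε hε2 c ρb μ).winU4 q`. [folklore] -/
theorem ag4_holds {q : ℂ × ℝ × ℝ} (h : |‖q.1‖ - (fishTgen ε hε hε2 c ρb μ).s₄| < eta ε) :
    (fishTgen ε hε hε2 c ρb μ).winU5 q = (fishTgen ε hε hε2 c ρb μ).winU4 q := by
  have es₄ : (fishTgen ε hε hε2 c ρb μ).s₄ = s4 ε := rfl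
  rw [es₄] at h
  have hη := eta_lt hε hε2
  obtain ⟨hα1, hα2⟩ := alpha_slab4 (h.trans (by linarith))
  refine (fishTgen ε hε hε2 c ρb μ).agree₄ ρA_pos (by show π / 3 < angleUp (rzero ε) ‖q.1‖; linarith [Real.pi_pos]) ?_
  show footY ρA (angleUp (rzero ε) ‖q.1‖) ≤ 11 * ρA / 5
  calc footY ρA (angleUp (rzero ε) ‖q.1‖) ≤ footY ρA (3 * π / 4) :=
        footY_le_footY ρA_pos (by linarith [Real.pi_pos]) hα2.le (by linarith [Real.pi_pos])
    _ = 2 * ρA := footY_three_pi_div_four ρA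
    _ ≤ 11 * ρA / 5 := by unfold ρA; norm_num

include hε2 in
/-- `(fishTgen ε hε hε2 c ρb μ).winU4 q = (fishTgen ε hε hε2 c ρb μ).winU3 q`. [folklore] -/
theorem ag5_holds {q : ℂ × ℝ × ℝ} (h : |‖q.1‖ - (fishTgen ε hε hε2 c ρb μ).s₅| < eta ε) :
    (fishTgen ε hε hε2 c ρb μ).winU4 q = (fishTgen ε hε hε2 c ρb μ).winU3 q := by
  have es₅ : (fishTgen ε hε hε2 c ρb μ).s₅ = s5 ε := rfl
  rw [es₅] at h
  have hη := eta_lt hε hε2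
  obtain ⟨-, hy1, hy2, hb⟩ := yfun_slab5 hε hε2 (c := c) (ρb := ρb) (μ := μ) (h.trans (by linarith))
  have hy3 : footY ρA (angleUp (rzero ε) ‖q.1‖) ≤ 1 := by linarith
  have hy4 : footY ρA (angleUp (rzero ε) ‖q.1‖) ≤ 13 / 10 := by linarith
  exact (fishTgen ε hε hε2 c ρb μ).agree₅ ρA_pos hb hy1 (vert_m_of_le hε hε2 hy3) (vert_θ_of_le hε hε2 hy4)
    (vert_σ₁_of_le hε hε2 hy4) (vert_σ₂_of_le hε hε2 hy4)

include hε2 in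
/-- `(fishTgen ε hε hε2 c ρb μ).winU3 q = (fishTgen ε hε hε2 c ρb μ).winU2 q`. [folklore] -/
theorem ag6_holds {q : ℂ × ℝ × ℝ} (h : |‖q.1‖ - (fishTgen ε hε hε2 c ρb μ).s₆| < eta ε) :
    (fishTgen ε hε hε2 c ρb μ).winU3 q = (fishTgen ε hε hε2 c ρb μ).winU2 q := by
  have es₆ : (fishTgen ε hε hε2 c ρb μ).s₆ = s6 ε := rfl
  rw [es₆] at h
  have hη := eta_lt hε hε2
  obtain ⟨-, hy1, hy2, hb⟩ := yfun_slab6 hε hε2 (c := c) (ρb := ρb) (μ := μ) (h.trans (by linarith))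
  obtain ⟨hβ1, hβ2, -⟩ := beta_slab6 (h.trans (by linarith))
  have hyh : (fishTgen ε hε hε2 c ρb μ).yh = cY := rfl
  have hy : 3 / 2 ≤ cY - footY R0 (angleDown (rone ε) ‖q.1‖) := by rw [cY]; linarith [Real.pi_gt_three]
  refine (fishTgen ε hε hε2 c ρb μ).agree₆ (nj_sq_lt ε hε) (nj_neg ε hε) R0_pos (lam_pos ε hε).ne' hb
    (by show π / 3 < angleDown (rone ε) ‖q.1‖; linarith [Real.pi_pos]) hy1 ?_ ?_ ?_ ?_
  · exact vert_m_of_ge hε hε2 (show 6 / 5 ≤ cY - footY R0 (angleDown (rone ε) ‖q.1‖) by linarith)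
  · exact vert_θ_of_ge hε hε2 (show 3 / 2 ≤ cY - footY R0 (angleDown (rone ε) ‖q.1‖) from hy)
  · rw [hyh]; exact vert_σ₁_of_ge hε hε2 hy
  · rw [hyh]; exact vert_σ₂_of_ge hε hε2 hy

include hε2 in
/-- `(fishTgen ε hε hε2 c ρb μ).winU2 q = (fishTgen ε hε hε2 c ρb μ).winU1 q`. [folklore] -/
theorem ag7_holds (hcρ : c * ρb = Lc ε) (hμ0 : ∀ r, r ≤ s7 ε + 1 / 25 → μ r = 0) {q : ℂ × ℝ × ℝ}
    (h : |‖q.1‖ - (fishTgen ε hε hε2 c ρb μ).s₇| < eta ε) :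
    (fishTgen ε hε hε2 c ρb μ).winU2 q = (fishTgen ε hε hε2 c ρb μ).winU1 q := by
  have es₇ : (fishTgen ε hε hε2 c ρb μ).s₇ = s7 ε := rfl
  rw [es₇] at h
  obtain ⟨hb, -, hβ1, hβ2⟩ := posL_slab7 hε hε2 (c := c) (ρb := ρb) (μ := μ) hcρ h
  have hη := eta_lt hε hε2
  have h3 : |‖q.1‖ - s7 ε| ≤ 3 / 100 := by obtain ⟨h1, h2⟩ := abs_lt.1 h; exact abs_le.2 ⟨by linarith, by linarith⟩
  have h4 := abs_rL_sub_le hε hε2 hcρ (μ := μ) h3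
  have hμ : μ ((fishTgen ε hε hε2 c ρb μ).rL (angleDown (rone ε) ‖q.1‖)) = 0 :=
    hμ0 _ (by have := (abs_le.1 h4).2; nlinarith [abs_nonneg (‖q.1‖ - s7 ε), h.le])
  exact (fishTgen ε hε hε2 c ρb μ).agree₇ R0_pos hb (by show -(π / 2) < angleDown (rone ε) ‖q.1‖; linarith [Real.pi_gt_three]) hβ2 hμ

end Agreements

/-! ### Helpers for the windows -/

section Helpers

/-- **The offset scaling** `(p₁, p₂, a, b) ↦ (p₁, p₂, λ a, λ b)` as a diffeomorphism (`λ ≠ 0`). [folklore] -/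
def scaleW {lam : ℝ} (hlam : lam ≠ 0) : (ℝ × ℝ × ℝ × ℝ) ≃ₘ⟮𝓘(ℝ, ℝ × ℝ × ℝ × ℝ), 𝓘(ℝ, ℝ × ℝ × ℝ × ℝ)⟯ (ℝ × ℝ × ℝ × ℝ) where
  toFun p := (p.1, p.2.1, lam * p.2.2.1, lam * p.2.2.2)
  invFun p := (p.1, p.2.1, lam⁻¹ * p.2.2.1, lam⁻¹ * p.2.2.2)
  left_inv p := by simp [hlam]
  right_inv p := by simp [hlam]
  contMDiff_toFun := contMDiff_iff_contDiff.2 (show ContDiff ℝ ∞ (fun p : ℝ × ℝ × ℝ × ℝ ↦ (p.1, p.2.1, lam * p.2.2.1, lam * p.2.2.2)) by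
    fun_prop)
  contMDiff_invFun := contMDiff_iff_contDiff.2 (show ContDiff ℝ ∞ (fun p : ℝ × ℝ × ℝ × ℝ ↦ (p.1, p.2.1, lam⁻¹ * p.2.2.1, lam⁻¹ * p.2.2.2)) by
    fun_prop)

/-- `scaleW hlam p = (p.1, p.2.1, lam * p.2.2.1, lam * p.2.2.2)`. [folklore] -/
@[simp] theorem scaleW_apply {lam : ℝ} (hlam : lam ≠ 0) (p : ℝ × ℝ × ℝ × ℝ) :
    scaleW hlam p = (p.1, p.2.1, lam * p.2.2.1, lam * p.2.2.2) := rfl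

/-- A diffeomorphism of the position factor, extended by the identity on the offsets. [folklore] -/
def prodDiffeoW (Φ : ℂ ≃ₘ⟮𝓘(ℝ, ℂ), 𝓘(ℝ, ℂ)⟯ ℂ) : (ℂ × ℝ × ℝ) ≃ₘ⟮𝓘(ℝ, ℂ × ℝ × ℝ), 𝓘(ℝ, ℂ × ℝ × ℝ)⟯ (ℂ × ℝ × ℝ) where
  toFun p := (Φ p.1, p.2)
  invFun p := (Φ.symm p.1, p.2)
  left_inv p := by simp
  right_inv p := by simp
  contMDiff_toFun := contMDiff_iff_contDiff.2
    (((contMDiff_iff_contDiff.1 Φ.contMDiff).comp contDiff_fst).prodMk contDiff_snd)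
  contMDiff_invFun := contMDiff_iff_contDiff.2
    (((contMDiff_iff_contDiff.1 Φ.symm.contMDiff).comp contDiff_fst).prodMk contDiff_snd)

/-- `prodDiffeoW Φ p = (Φ p.1, p.2)`. [folklore] -/
@[simp] theorem prodDiffeoW_apply (Φ : ℂ ≃ₘ⟮𝓘(ℝ, ℂ), 𝓘(ℝ, ℂ)⟯ ℂ) (p : ℂ × ℝ × ℝ) : prodDiffeoW Φ p = (Φ p.1, p.2) := rfl

/-- A piece precomposed with the offset scaling is a local diffeomorphism where the piece is. [folklore] -/
theorem isLocalDiffeomorphAt_comp_scaleW {M : Type*} [TopologicalSpace M] [ChartedSpace (𝔼 4) M] {lam : ℝ} (hlam : lam ≠ 0)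
    {F : ℝ × ℝ × ℝ × ℝ → M} {p : ℝ × ℝ × ℝ × ℝ}
    (hF : IsLocalDiffeomorphAt 𝓘(ℝ, ℝ × ℝ × ℝ × ℝ) 𝓘(ℝ, 𝔼 4) ∞ F (p.1, p.2.1, lam * p.2.2.1, lam * p.2.2.2)) :
    IsLocalDiffeomorphAt 𝓘(ℝ, ℝ × ℝ × ℝ × ℝ) 𝓘(ℝ, 𝔼 4) ∞ (fun p : ℝ × ℝ × ℝ × ℝ ↦ F (p.1, p.2.1, lam * p.2.2.1, lam * p.2.2.2)) p :=
  ((scaleW hlam).isLocalDiffeomorph p).comp (K := 𝓘(ℝ, 𝔼 4)) (P := M) hF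

/-- `|a sin ℓ + b cos ℓ|, |a cos ℓ - b sin ℓ| ≤ √(a² + b²)`. [folklore] -/
theorem abs_rotAB_le (ℓ a b : ℝ) : |(rotAB ℓ a b).1| ≤ Real.sqrt (a ^ 2 + b ^ 2) ∧ |(rotAB ℓ a b).2| ≤ Real.sqrt (a ^ 2 + b ^ 2) := by
  have hsc := Real.sin_sq_add_cos_sq ℓ
  constructor
  · rw [rotAB, abs_neg, ← Real.sqrt_sq_eq_abs]
    refine Real.sqrt_le_sqrt ?_
    nlinarith [sq_nonneg (a * Real.cos ℓ - b * Real.sin ℓ)]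
  · rw [rotAB, ← Real.sqrt_sq_eq_abs]
    refine Real.sqrt_le_sqrt ?_
    nlinarith [sq_nonneg (a * Real.sin ℓ + b * Real.cos ℓ)]

/-- `|re (e^{iϑ} w)|, |im (e^{iϑ} w)| ≤ √(a² + b²)` for `w = a + bi`. [folklore] -/
theorem abs_re_im_rot_le (ϑ a b : ℝ) :
    |(exp (ϑ * I) * (a + b * I)).re| ≤ Real.sqrt (a ^ 2 + b ^ 2) ∧ |(exp (ϑ * I) * (a + b * I)).im| ≤ Real.sqrt (a ^ 2 + b ^ 2) := by
  have hn : ‖exp (ϑ * I) * (a + b * I)‖ = Real.sqrt (a ^ 2 + b ^ 2) := by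
    rw [norm_mul, Complex.norm_exp_ofReal_mul_I, one_mul, Complex.norm_def, Complex.normSq_apply]
    simp; ring_nf
  rw [← hn]
  exact ⟨Complex.abs_re_le_norm _, Complex.abs_im_le_norm _⟩

/-- The position of the collar-annulus piece has norm `|X|`. [folklore] -/
theorem norm_shellTubeMap_fst (F : ℝ × ℝ → ℝ × ℝ) (q : ℝ × ℝ × ℝ × ℝ) :
    ‖(shellTubeMap F q).1‖ = |(F (q.1, q.2.2.1)).1| := by
  simp only [shellTubeMap, profTubeMap, profTube]
  rw [norm_mul, Complex.norm_real, Complex.norm_exp_ofReal_mul_I, mul_one, Real.norm_eq_abs]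

/-- The position of the wall piece has norm at most `2ρ + |a| + |b|` (`ρ > 0`). [folklore] -/
theorem norm_tubeUpMap_fst_le {ρ : ℝ} (hρ : 0 < ρ) (q : ℝ × ℝ × ℝ × ℝ) :
    ‖(tubeUpMap ρ q).1‖ ≤ 2 * ρ + |q.2.2.1| + |q.2.2.2| := by
  simp only [tubeUpMap, tubeUp]
  rw [norm_mul, Complex.norm_exp_ofReal_mul_I, mul_one]
  have hu : 0 ≤ uU ρ q.1 ∧ uU ρ q.1 ≤ 2 * ρ := by
    rw [uU]
    have h0 := Real.smoothTransition.nonneg ((q.1 - 3 * ρ) / ρ)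
    have h1 := Real.smoothTransition.le_one ((q.1 - 3 * ρ) / ρ)
    constructor <;> nlinarith
  have hχ : 0 ≤ chiU ρ q.1 ∧ chiU ρ q.1 ≤ 1 := by
    rw [chiU]
    have h0 := Real.smoothTransition.nonneg ((q.1 - 11 * ρ / 5) / (4 * ρ / 5))
    have h1 := Real.smoothTransition.le_one ((q.1 - 11 * ρ / 5) / (4 * ρ / 5))
    constructor <;> linarith
  have hK1 := footKc_le_one hρ q.1
  have hK0 := footKc_nonneg hρ q.1
  calc ‖(((uU ρ q.1 + q.2.2.1 * footKc ρ q.1 : ℝ) : ℂ) + (((1 - chiU ρ q.1) * q.2.2.2 : ℝ) : ℂ) * I)‖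
      ≤ ‖((uU ρ q.1 + q.2.2.1 * footKc ρ q.1 : ℝ) : ℂ)‖ + ‖(((1 - chiU ρ q.1) * q.2.2.2 : ℝ) : ℂ) * I‖ := norm_add_le _ _
    _ = |uU ρ q.1 + q.2.2.1 * footKc ρ q.1| + |(1 - chiU ρ q.1) * q.2.2.2| := by
        rw [norm_mul, Complex.norm_I, mul_one, Complex.norm_real, Complex.norm_real, Real.norm_eq_abs, Real.norm_eq_abs]
    _ ≤ 2 * ρ + |q.2.2.1| + |q.2.2.2| := by
        have h1 : |uU ρ q.1 + q.2.2.1 * footKc ρ q.1| ≤ 2 * ρ + |q.2.2.1| := by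
          calc |uU ρ q.1 + q.2.2.1 * footKc ρ q.1| ≤ |uU ρ q.1| + |q.2.2.1 * footKc ρ q.1| := abs_add_le _ _
            _ ≤ 2 * ρ + |q.2.2.1| := by
                rw [abs_of_nonneg hu.1, abs_mul, abs_of_nonneg hK0]; nlinarith [abs_nonneg q.2.2.1]
        have h2 : |(1 - chiU ρ q.1) * q.2.2.2| ≤ |q.2.2.2| := by
          rw [abs_mul, abs_of_nonneg (by linarith)]; nlinarith [abs_nonneg q.2.2.2]
        linarith

/-- Strict convex combinations stay in an open interval. [folklore] -/
theorem convex_combo_mem_Ioo {χ A B x y : ℝ} (h0 : 0 ≤ χ) (h1 : χ ≤ 1) (hx : x ∈ Ioo A B) (hy : y ∈ Ioo A B) :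
    (1 - χ) * x + χ * y ∈ Ioo A B := by
  obtain ⟨hx1, hx2⟩ := hx; obtain ⟨hy1, hy2⟩ := hy
  have he : (1 - χ) * x + χ * y = x + χ * (y - x) := by ring
  rw [he]
  constructor
  · rcases le_or_gt x y with hxy | hxy
    · nlinarith [mul_nonneg h0 (sub_nonneg.2 hxy)]
    · nlinarith [mul_le_mul_of_nonneg_left h1 (sub_pos.2 hxy).le]
  · rcases le_or_gt x y with hxy | hxy
    · nlinarith [mul_le_mul_of_nonneg_right h1 (sub_nonneg.2 hxy)]
    · nlinarith [mul_nonneg h0 (sub_pos.2 hxy).le]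

/-- A latitude threshold: `47/100 < ‖d‖ → 21ε/50 < n₀`. [folklore] -/
theorem lt_neg_capN_of_lt_norm'' (hε : 0 < ε) {d : ℂ} (h : 47 / 100 < ‖d‖) : 21 * ε / 50 < -capN ε d := by
  rw [neg_capN_eq]
  have hs : 0 < Real.sqrt (1 + ‖d‖ ^ 2) := Real.sqrt_pos.2 (by positivity)
  have h1 : 21 / 50 < ‖d‖ / Real.sqrt (1 + ‖d‖ ^ 2) := by
    rw [lt_div_iff₀ hs]
    have h2 : Real.sqrt (1 + ‖d‖ ^ 2) < ‖d‖ / (21 / 50) := by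
      rw [Real.sqrt_lt' (by positivity)]
      nlinarith
    have := mul_lt_mul_of_pos_left h2 (by norm_num : (0:ℝ) < 21 / 50)
    rwa [mul_div_cancel₀ _ (by norm_num : (21 / 50 : ℝ) ≠ 0)] at this
  have h3 := mul_lt_mul_of_pos_left h1 hε
  calc 21 * ε / 50 = ε * (21 / 50) := by ring
    _ < ε * (‖d‖ / Real.sqrt (1 + ‖d‖ ^ 2)) := h3
    _ = ε * ‖d‖ / Real.sqrt (1 + ‖d‖ ^ 2) := (mul_div_assoc _ _ _).symm

include hε2 in
/-- **The rescaled-zone admissibility**: for `λ ≤ n₀` and admissible offsets, `kap n₀ ≠ 0` and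
`(kap n₀ a)² + (kap n₀ b)² < n₀²`. [folklore] -/
theorem kap_adm {n₀ : ℝ} (hn : lam ε ≤ n₀) {w : ℝ × ℝ} (hw : w ∈ DiscP ε hε hε2) :
    kap ε n₀ ≠ 0 ∧ (kap ε n₀ * w.1) ^ 2 + (kap ε n₀ * w.2) ^ 2 < n₀ ^ 2 := by
  have hl := lam_pos ε hε
  obtain ⟨h1, h2⟩ := kap_mem (ε := ε) n₀
  rw [min_eq_right hn] at h1; rw [max_eq_left hn] at h2
  have hρ := rhoB_le hε hε2
  have hρ0 := rhoB_pos hε hε2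
  have h3 : w.1 ^ 2 + w.2 ^ 2 < rhoB ε hε hε2 ^ 2 := hw
  have hk0 : 0 < kap ε n₀ := by linarith
  refine ⟨hk0.ne', ?_⟩
  have : (kap ε n₀ * w.1) ^ 2 + (kap ε n₀ * w.2) ^ 2 = kap ε n₀ ^ 2 * (w.1 ^ 2 + w.2 ^ 2) := by ring
  rw [this]
  have h4 : w.1 ^ 2 + w.2 ^ 2 < 1 := by nlinarith [pow_le_pow_left₀ hρ0.le hρ 2]
  have h5 : kap ε n₀ ^ 2 ≤ n₀ ^ 2 := pow_le_pow_left₀ hk0.le h2 2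
  calc kap ε n₀ ^ 2 * (w.1 ^ 2 + w.2 ^ 2) < kap ε n₀ ^ 2 * 1 := mul_lt_mul_of_pos_left h4 (by positivity)
    _ ≤ n₀ ^ 2 := by linarith

include hε2 in
/-- **The switch-zone admissibility**: for `n₀ ≥ 21ε/50`, admissible offsets, and a profile
`μ` with values in `[0,1]` and `|μ'| ≤ C₀/(ε/25)`: the offsets are admissible with scale `λ`,
`|λ b| < 1/4`, `|λ b| < n₀`, and the switch Jacobian (with `B = ± λ b`) is nonzero. [folklore] -/
theorem switch_adm {μ : ℝ → ℝ} (hμ01 : ∀ n, 0 ≤ μ n ∧ μ n ≤ 1) (hμ' : ∀ n, |deriv μ n| ≤ C0 / (ε / 25)) {n₀ : ℝ}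
    (hn : 21 * ε / 50 ≤ n₀) {w : ℝ × ℝ} (hw : w ∈ DiscP ε hε hε2) (sgn : ℝ) (hsgn : sgn = 1 ∨ sgn = -1) :
    (lam ε * w.1) ^ 2 + (lam ε * w.2) ^ 2 < n₀ ^ 2 ∧ |lam ε * w.2| < 1 / 4 ∧ |lam ε * w.2| < n₀ ∧
      -deriv μ n₀ * sphX n₀ (lam ε * w.1) (lam ε * (sgn * w.2)) +
        (1 - μ n₀) * (n₀ / Real.sqrt (n₀ ^ 2 - (lam ε * w.1) ^ 2 - (lam ε * (sgn * w.2)) ^ 2)) +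
        (deriv μ n₀ * (n₀ + lam ε * (sgn * w.2)) + μ n₀ * 1) ≠ 0 := by
  have hl := lam_pos ε hε; have hl' := lam_le ε hε
  obtain ⟨hs, ha, hb⟩ := disc_bounds hε2 hw
  have hρ := rhoB_pos hε hε2; have hρε := rhoB_le_eps hε hε2
  have hn0 : 0 < n₀ := by linarith
  have hsg2 : sgn ^ 2 = 1 := by rcases hsgn with h | h <;> rw [h] <;> norm_num
  have hAB : (lam ε * w.1) ^ 2 + (lam ε * w.2) ^ 2 < (lam ε * rhoB ε hε hε2) ^ 2 := by
    have : (lam ε * w.1) ^ 2 + (lam ε * w.2) ^ 2 = lam ε ^ 2 * (w.1 ^ 2 + w.2 ^ 2) := by ring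
    rw [this, mul_pow]; exact mul_lt_mul_of_pos_left (show w.1 ^ 2 + w.2 ^ 2 < rhoB ε hε hε2 ^ 2 from hw) (by positivity)
  have hlr : lam ε * rhoB ε hε hε2 ≤ ε * ε / 80 := by
    calc lam ε * rhoB ε hε hε2 ≤ (ε / 10) * (ε / 8) := mul_le_mul hl' hρε hρ.le (by linarith)
      _ = ε * ε / 80 := by ring
  have hlr1 : lam ε * rhoB ε hε hε2 < n₀ := by nlinarith
  have hAB' : (lam ε * w.1) ^ 2 + (lam ε * w.2) ^ 2 < n₀ ^ 2 := by
    have : (lam ε * rhoB ε hε hε2) ^ 2 < n₀ ^ 2 := by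
      exact pow_lt_pow_left₀ hlr1 (by positivity) two_ne_zero
    linarith
  have hb' : |lam ε * w.2| < lam ε * rhoB ε hε hε2 := by rw [abs_mul, abs_of_pos hl]; exact mul_lt_mul_of_pos_left hb hl
  refine ⟨hAB', by nlinarith, by linarith, ?_⟩
  -- the Jacobian
  have hABs : (lam ε * w.1) ^ 2 + (lam ε * (sgn * w.2)) ^ 2 < n₀ ^ 2 := by
    rw [show (lam ε * (sgn * w.2)) ^ 2 = (lam ε * w.2) ^ 2 by rw [mul_pow, mul_pow, mul_pow, hsg2, one_mul]]; exact hAB'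
  refine (jac_switch_pos (hμ01 n₀).2 (hμ' n₀) hn0 hABs ?_).ne'
  -- smallness: `M (|B| + (A²+B²)/n) < 1` with `|B| ≤ λρ_b`, `(A²+B²)/n ≤ λρ_b`
  have hB : |lam ε * (sgn * w.2)| < lam ε * rhoB ε hε hε2 := by
    have habs : |sgn| = 1 := by rcases hsgn with h | h <;> rw [h] <;> norm_num
    rw [show lam ε * (sgn * w.2) = sgn * (lam ε * w.2) by ring, abs_mul, habs, one_mul]; exact hb'
  have hQ : ((lam ε * w.1) ^ 2 + (lam ε * (sgn * w.2)) ^ 2) / n₀ ≤ lam ε * rhoB ε hε hε2 := by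
    rw [div_le_iff₀ hn0, show (lam ε * (sgn * w.2)) ^ 2 = (lam ε * w.2) ^ 2 by rw [mul_pow, mul_pow, mul_pow, hsg2, one_mul]]
    have : (lam ε * rhoB ε hε hε2) ^ 2 ≤ lam ε * rhoB ε hε hε2 * n₀ := by
      rw [sq]; exact mul_le_mul_of_nonneg_left hlr1.le (by positivity)
    linarith
  have hC := C0_pos
  calc C0 / (ε / 25) * (|lam ε * (sgn * w.2)| + ((lam ε * w.1) ^ 2 + (lam ε * (sgn * w.2)) ^ 2) / n₀)
      ≤ C0 / (ε / 25) * (2 * (lam ε * rhoB ε hε hε2)) := mul_le_mul_of_nonneg_left (by linarith) (by positivity)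
    _ ≤ C0 / (ε / 25) * (2 * (ε / (10 * (C0 + 1)) * (ε / 8))) := by
        refine mul_le_mul_of_nonneg_left ?_ (by positivity)
        refine mul_le_mul_of_nonneg_left ?_ (by norm_num)
        unfold lam; exact mul_le_mul_of_nonneg_left hρε (by positivity)
    _ = 5 / 8 * (C0 / (C0 + 1)) * ε := by field_simp; ring
    _ < 1 := by
        have h1 : C0 / (C0 + 1) < 1 := by rw [div_lt_one (by linarith)]; linarith
        have h2 : 0 < C0 / (C0 + 1) := by positivity
        nlinarith

end Helpers

/-! ### The windows are local diffeomorphisms -/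

section Windows

include hε2 in
/-- **Window S.** [folklore] -/
theorem ldS_holds {q : ℂ × ℝ × ℝ} (hq : q.2 ∈ DiscP ε hε hε2) (h : ‖q.1‖ < (fishTgen ε hε hε2 c ρb μ).s₁ + eta ε) :
    IsLocalDiffeomorphAt 𝓘(ℝ, ℂ × ℝ × ℝ) 𝓘(ℝ, 𝔼 4) ∞ (fishTgen ε hε hε2 c ρb μ).winS q := by
  have es₁ : (fishTgen ε hε hε2 c ρb μ).s₁ = 3 / 4 := rfl
  rw [es₁] at h
  have hη := eta_lt hε hε2
  have hl := lam_le ε hε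
  refine isLocalDiffeomorphAt_tubeD0S (fishTgen ε hε hε2 c ρb μ).hε (fishTgen ε hε hε2 c ρb μ).hε2 contDiff_kap one_ne_zero
    (fun d hd ↦ by rw [one_mul]; exact kap_of_le hε (neg_capN_lt_of_norm_lt hε hd).le) (by linarith) (fun _ ↦ ?_) (fun h2 ↦ ?_)
  · have hρ := rhoB_le hε hε2; have hρ0 := rhoB_pos hε hε2
    have h3 : q.2.1 ^ 2 + q.2.2 ^ 2 < rhoB ε hε hε2 ^ 2 := hq
    simp only [one_mul]; nlinarith [pow_le_pow_left₀ hρ0.le hρ 2]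
  · have hn := lt_neg_capN_of_lt_norm'' hε h2
    exact kap_adm hε2 (show lam ε ≤ -capN ε q.1 by linarith) hq

include hε2 in
/-- **Window A.** [folklore] -/
theorem ldA_holds {q : ℂ × ℝ × ℝ} (hq : q.2 ∈ DiscP ε hε hε2) (h : (fishTgen ε hε hε2 c ρb μ).s₁ - eta ε < ‖q.1‖)
    (h' : ‖q.1‖ < (fishTgen ε hε hε2 c ρb μ).s₂ + eta ε) :
    IsLocalDiffeomorphAt 𝓘(ℝ, ℂ × ℝ × ℝ) 𝓘(ℝ, 𝔼 4) ∞ (fishTgen ε hε hε2 c ρb μ).winA q := by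
  set T := fishTgen ε hε hε2 c ρb μ with hT
  have es₁ : T.s₁ = 3 / 4 := rfl
  have es₂ : T.s₂ = s2 ε := rfl
  rw [es₁] at h; rw [es₂] at h'
  have hη := eta_lt hε hε2; have hη0 := eta_pos ε hε
  obtain ⟨hs21, hs22⟩ := s2_bounds hε hε2
  obtain ⟨hi1, hi2⟩ := inv_sqrt_three_bounds
  have hr0 : rzero ε = 12 + ε / 100 := by unfold rzero b2; ring
  have hl := lam_le ε hε; have hl0 := lam_pos ε hε
  have hd : q.1 ≠ 0 := fun h0 ↦ by rw [h0, norm_zero] at h; linarith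
  have hlt : ‖q.1‖ < rzero ε - 1 / Real.sqrt 3 := by linarith
  obtain ⟨hn1, hn2⟩ := nfun_winA hε hε2 (c := c) (ρb := ρb) (μ := μ) (r := ‖q.1‖) (by linarith) h'
  have hper : ∀ n ϑ (w : ℝ × ℝ), tubeD0A T.hε T.hε2 T.δ T.lam T.cut T.kapS T.μS T.nA T.nB (n, ϑ + 2 * π, w) =
      tubeD0A T.hε T.hε2 T.δ T.lam T.cut T.kapS T.μS T.nA T.nB (n, ϑ, w) := fun n ϑ w ↦ tubeD0A_add_two_pi T.hε T.hε2 (n, ϑ, w)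
  have hpos : ∀ᶠ t in 𝓝 ‖q.1‖, ContDiffAt ℝ ∞ T.nfun t := by
    filter_upwards [Iio_mem_nhds hlt] with t ht using contDiffAt_nfun hε hε2 (c := c) (ρb := ρb) (μ := μ) ht
  refine isLocalDiffeomorphAt_radialForm hper hd hpos (deriv_nfun_pos hε hε2 (c := c) (ρb := ρb) (μ := μ) (by linarith) hlt).ne' ?_
  -- the angular tube at `(n, ϑ, a, b)`
  refine isLocalDiffeomorphAt_tubeD0A T.hε T.hε2 (d0APlateau hε hε2) (by exact lt_trans (by positivity) hn1)
    (by exact lt_trans hn2 (by linarith)) (fun h2 ↦ ?_) (fun h3 h3' ↦ ?_) (fun hM ↦ ?_)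
  · change T.nfun ‖q.1‖ < nA ε + etaA ε at h2
    unfold nA etaA at h2
    obtain ⟨hk1, hk2⟩ := kap_adm hε2 (n₀ := T.nfun ‖q.1‖) (by linarith) hq
    exact ⟨by linarith, hk1, hk2⟩
  · change nA ε - etaA ε < T.nfun ‖q.1‖ at h3
    unfold nA etaA at h3
    have hμ' : ∀ n, |deriv (muS ε) n| ≤ C0 / (ε / 25) := fun n ↦ by
      have := abs_deriv_stdBlend_le (a := 7 * ε / 10) (b := 43 * ε / 50) (by linarith) n
      rw [show 43 * ε / 50 - 7 * ε / 10 = 4 * ε / 25 by ring] at this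
      have hC := C0_pos
      exact this.trans (by rw [div_le_div_iff₀ (by positivity) (by positivity)]; nlinarith)
    have := switch_adm hε2 (μ := muS ε) (fun n ↦ stdBlend_mem _ _ n) hμ' (n₀ := T.nfun ‖q.1‖) (by linarith) hq 1 (Or.inl rfl)
    simpa only [one_mul] using this
  · change nB ε - etaA ε < T.nfun ‖q.1‖ at hM
    unfold nB etaA at hM
    have hnj : nj ε = -(9 * ε / 10) := rfl
    show ((Circle.exp (T.nfun ‖q.1‖) : Circle) : ℂ) * exp (-((nj ε + π : ℝ) : ℂ) * I) ∈ slitPlane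
    exact mul_exp_mem_slitPlane_of_mem_Ioo (by rw [hnj]; linarith) (by rw [hnj]; linarith)

include hε2 in
/-- **Window N.** [folklore] -/
theorem ldN_holds {q : ℂ × ℝ × ℝ} (hq : q.2 ∈ DiscP ε hε hε2) (h : (fishTgen ε hε hε2 c ρb μ).s₂ - eta ε < ‖q.1‖)
    (h' : ‖q.1‖ < (fishTgen ε hε hε2 c ρb μ).s₃ + eta ε) :
    IsLocalDiffeomorphAt 𝓘(ℝ, ℂ × ℝ × ℝ) 𝓘(ℝ, 𝔼 4) ∞ (fishTgen ε hε hε2 c ρb μ).winN q := by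
  set T := fishTgen ε hε hε2 c ρb μ with hT
  have es₂ : T.s₂ = s2 ε := rfl
  have es₃ : T.s₃ = s3 ε := rfl
  rw [es₂] at h; rw [es₃] at h'
  have hη := eta_lt hε hε2; have hη0 := eta_pos ε hε
  obtain ⟨hs21, hs22⟩ := s2_bounds hε hε2
  obtain ⟨hi1, hi2⟩ := inv_sqrt_three_bounds
  obtain ⟨htj1, htj2⟩ := capTj_bounds ε hε
  have hl := lam_le ε hε; have hl0 := lam_pos ε hε
  have hd : q.1 ≠ 0 := fun h0 ↦ by rw [h0, norm_zero] at h; linarith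
  have hlt : ‖q.1‖ < rzero ε - 1 / Real.sqrt 3 := by unfold s3 at h'; linarith
  have hopen : IsOpen {t : ℝ | s2 ε - eta ε < t ∧ t < rzero ε - 1 / Real.sqrt 3} :=
    (isOpen_lt continuous_const continuous_id).inter (isOpen_lt continuous_id continuous_const)
  have hpos : ∀ᶠ t in 𝓝 ‖q.1‖, ContDiffAt ℝ ∞ T.Pfun t := by
    filter_upwards [hopen.mem_nhds ⟨h, hlt⟩] with t ht using contDiffAt_Pfun hε hε2 (c := c) (ρb := ρb) (μ := μ) ht.1 ht.2
  have hP := Pfun_pos hε hε2 (c := c) (ρb := ρb) (μ := μ) h hlt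
  have h₁ := isLocalDiffeomorphAt_radMapW hd hpos hP.ne' (deriv_Pfun_ne_zero hε hε2 (c := c) (ρb := ρb) (μ := μ) h hlt)
  -- the translated north tube `(d, w) ↦ tubeD0N (tdisc d, w)` at `radMapW Pfun q`
  have hG : IsLocalDiffeomorphAt 𝓘(ℝ, ℂ × ℝ × ℝ) 𝓘(ℝ, 𝔼 4) ∞
      (fun p : ℂ × ℝ × ℝ ↦ tubeD0N T.hε T.hε2 (capTj T.ε T.nj) T.δ T.rσ₁ T.rσ₂ T.rσ₃ T.lam T.cN T.kapN T.μN T.cut T.RM (T.tdisc p.1, p.2))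
      (radMapW T.Pfun q) := by
    set p := radMapW T.Pfun q with hp
    have hD : IsLocalDiffeomorphAt 𝓘(ℝ, ℂ × ℝ × ℝ) 𝓘(ℝ, ℂ × ℝ × ℝ) ∞ (fun p : ℂ × ℝ × ℝ ↦ (T.tdisc p.1, p.2)) p :=
      (prodDiffeoW T.tdisc).isLocalDiffeomorph p
    refine hD.comp (K := 𝓘(ℝ, 𝔼 4)) (P := (fishNu T.hε T.hε2).Surgered) ?_
    -- the north tube at `(tdisc p.1, a, b)`
    set d := T.tdisc p.1 with hdd
    have hμ' : ∀ n, |deriv (muN ε) n| ≤ C0 / (ε / 25) := fun n ↦ by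
      have := abs_deriv_stdBlend_le (a := 113 * ε / 200) (b := 121 * ε / 200) (by linarith) n
      rwa [show 121 * ε / 200 - 113 * ε / 200 = ε / 25 by ring] at this
    refine isLocalDiffeomorphAt_tubeD0N T.hε T.hε2 (show ε < π by linarith [Real.pi_gt_three]) (d0NPlateau hε hε2)
      (q := (d, p.2)) (fun _ ↦ ?_) (fun h2 _ ↦ ?_) (fun h3 _ ↦ ?_) (fun h4 _ ↦ ?_)
    · have hρ := rhoB_le hε hε2; have hρ0 := rhoB_pos hε hε2
      have h3 : q.2.1 ^ 2 + q.2.2 ^ 2 < rhoB ε hε hε2 ^ 2 := hq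
      show (1 * q.2.1) ^ 2 + (1 * q.2.2) ^ 2 < 1
      simp only [one_mul]; nlinarith [pow_le_pow_left₀ hρ0.le hρ 2]
    · have hn := lt_neg_capN_of_lt_norm'' hε h2
      exact kap_adm hε2 (show lam ε ≤ -capN ε d by linarith) hq
    · have hn := lt_neg_capN_of_lt_norm hε h3
      have := switch_adm hε2 (μ := muN ε) (fun n ↦ stdBlend_mem _ _ n) hμ' (n₀ := -capN ε d) (by linarith) hq (-1) (Or.inr rfl)
      simp only [neg_one_mul] at this
      exact this
    · -- the section is smooth near `d ≠ d₀`
      have hd0 : d ≠ dCenter (capTj ε (nj ε)) := by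
        intro hdc
        have h0 : T.tdisc 0 = capD0 ε (nj ε) := by
          show transDisc (d₀ := capD0 T.ε T.nj) T.hC T.hR₁ T.hR₁₂ T.hroom 0 = _
          rw [transDisc_of_norm_le _ _ _ _ (by rw [norm_zero]; exact T.hR₁), zero_add]; rfl
        have h1 : T.tdisc p.1 = T.tdisc 0 := by rw [h0, capD0_eq, ← hdd]; exact hdc
        have : p.1 = 0 := T.tdisc.injective h1
        rw [hp, radMapW_apply] at this
        simp only [mul_eq_zero, Complex.ofReal_eq_zero, Complex.exp_ne_zero, or_false] at this
        exact hP.ne' this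
      exact eventually_contMDiffAt_sigmaCapC htj1 htj2 hd0
  have := h₁.comp (K := 𝓘(ℝ, 𝔼 4)) (P := (fishNu T.hε T.hε2).Surgered) hG
  exact this

include hε2 in
/-- **Window U5** at any position with `-π/4 ≤ α ≤ π - arctan (1/3)`, `r ≠ 0`. [folklore] -/
theorem ldU5_holds' {q : ℂ × ℝ × ℝ} (hq : q.2 ∈ DiscP ε hε hε2) (hd : q.1 ≠ 0) (hψ1 : -(π / 4) ≤ angleUp (rzero ε) ‖q.1‖)
    (hψ2 : angleUp (rzero ε) ‖q.1‖ ≤ π - Real.arctan (1 / 3)) :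
    IsLocalDiffeomorphAt 𝓘(ℝ, ℂ × ℝ × ℝ) 𝓘(ℝ, 𝔼 4) ∞ (fishTgen ε hε hε2 c ρb μ).winU5 q := by
  set T := fishTgen ε hε hε2 c ρb μ with hT
  obtain ⟨htj1, htj2⟩ := capTj_bounds ε hε
  have hl := lam_le ε hε; have hl0 := lam_pos ε hε
  obtain ⟨hs, ha, hb⟩ := disc_bounds hε2 hq
  have hρ := rhoB_le hε hε2; have hρε := rhoB_le_eps hε hε2
  have hper : ∀ n ϑ (w : ℝ × ℝ), (fun p : ℝ × ℝ × ℝ × ℝ ↦ pieceU5 T.hε T.hε2 T.nj T.ρA (p.1, p.2.1, T.lam * p.2.2.1, T.lam * p.2.2.2)) (n, ϑ + 2 * π, w) =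
      (fun p : ℝ × ℝ × ℝ × ℝ ↦ pieceU5 T.hε T.hε2 T.nj T.ρA (p.1, p.2.1, T.lam * p.2.2.1, T.lam * p.2.2.2)) (n, ϑ, w) :=
    fun n ϑ w ↦ pieceU5_add_two_pi T.hε T.hε2 (n, ϑ, T.lam * w.1, T.lam * w.2)
  refine isLocalDiffeomorphAt_radialForm hper hd (Eventually.of_forall fun t ↦ (contDiff_angleUp _).contDiffAt)
    (deriv_angleUp_pos _ _).ne' ?_
  refine isLocalDiffeomorphAt_comp_scaleW hl0.ne' ?_
  have hla : |lam ε * q.2.1| < rhoB ε hε hε2 / 10 := by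
    rw [abs_mul, abs_of_pos hl0]
    calc lam ε * |q.2.1| ≤ (1 / 10) * |q.2.1| := mul_le_mul_of_nonneg_right (by linarith) (abs_nonneg _)
      _ < rhoB ε hε hε2 / 10 := by linarith
  have hX := fst_pathShell_mem ρA_pos (q := (angleUp (rzero ε) ‖q.1‖, lam ε * q.2.1)) hψ1 (by linarith [(angleUp_mem (rzero ε) ‖q.1‖).2])
    (by show |lam ε * q.2.1| < ρA / 2; unfold ρA; linarith)
  have hρA := ρA_pos
  refine isLocalDiffeomorphAt_pieceU5 T.hε T.hε2 ρA_pos (jacRad_spec ρA ρA_pos) hψ1 hψ2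
    (lt_of_lt_of_le hla (by linarith [rhoB_le_jacA hε hε2, jacRad_pos ρA ρA_pos]))
    (show 0 < (pathShell ρA (angleUp (rzero ε) ‖q.1‖, lam ε * q.2.1)).1 by linarith [hX.1]) ?_
  show ‖(shellTubeMap (pathShell ρA) (angleUp (rzero ε) ‖q.1‖, arg q.1, lam ε * q.2.1, lam ε * q.2.2)).1‖ < capTj ε (nj ε)
  rw [norm_shellTubeMap_fst, abs_of_pos (by linarith [hX.1] : 0 < (pathShell ρA (angleUp (rzero ε) ‖q.1‖, lam ε * q.2.1)).1)]
  have : 9 * ρA / 2 < 2 := by unfold ρA; norm_num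
  linarith [hX.2]

include hε2 in
/-- **Window U5.** [folklore] -/
theorem ldU5_holds {q : ℂ × ℝ × ℝ} (hq : q.2 ∈ DiscP ε hε hε2) (h : (fishTgen ε hε hε2 c ρb μ).s₃ - eta ε < ‖q.1‖)
    (h' : ‖q.1‖ < (fishTgen ε hε hε2 c ρb μ).s₄ + eta ε) :
    IsLocalDiffeomorphAt 𝓘(ℝ, ℂ × ℝ × ℝ) 𝓘(ℝ, 𝔼 4) ∞ (fishTgen ε hε hε2 c ρb μ).winU5 q := by
  have es₃ : (fishTgen ε hε hε2 c ρb μ).s₃ = s3 ε := rfl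
  have es₄ : (fishTgen ε hε hε2 c ρb μ).s₄ = s4 ε := rfl
  rw [es₃] at h; rw [es₄] at h'
  have hη := eta_lt hε hε2
  obtain ⟨hi1, hi2⟩ := inv_sqrt_three_bounds
  have hr0 : rzero ε = 12 + ε / 100 := by unfold rzero b2; ring
  obtain ⟨hα1, hα2⟩ := alpha_winU5 (ε := ε) (r := ‖q.1‖) (by linarith) (by linarith)
  have hd : q.1 ≠ 0 := fun h0 ↦ by rw [h0, norm_zero] at h; unfold s3 at h; linarith
  have hA3 : Real.arctan (1 / 3) < π / 4 := by
    rw [← Real.arctan_one]; exact Real.arctan_strictMono (by norm_num)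
  exact ldU5_holds' hε2 hq hd hα1.le (by linarith)

include hε2 in
/-- **Window U4.** [folklore] -/
theorem ldU4_holds {q : ℂ × ℝ × ℝ} (hq : q.2 ∈ DiscP ε hε hε2) (h : (fishTgen ε hε hε2 c ρb μ).s₄ - eta ε < ‖q.1‖)
    (_h' : ‖q.1‖ < (fishTgen ε hε hε2 c ρb μ).s₅ + eta ε) :
    IsLocalDiffeomorphAt 𝓘(ℝ, ℂ × ℝ × ℝ) 𝓘(ℝ, 𝔼 4) ∞ (fishTgen ε hε hε2 c ρb μ).winU4 q := by
  set T := fishTgen ε hε hε2 c ρb μ with hT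
  have es₄ : T.s₄ = s4 ε := rfl
  rw [es₄] at h
  have hη := eta_lt hε hε2
  obtain ⟨htj1, htj2⟩ := capTj_bounds ε hε
  have hl := lam_le ε hε; have hl0 := lam_pos ε hε
  obtain ⟨hs, ha, hb⟩ := disc_bounds hε2 hq
  have hρ := rhoB_le hε hε2
  have hwin : s4 ε - 1 / 10 < ‖q.1‖ := by linarith
  have hαlo := alpha_gt_pi_div_two hwin
  have hαhi := (angleUp_mem (rzero ε) ‖q.1‖).2
  have hd : q.1 ≠ 0 := fun h0 ↦ by
    rw [h0, norm_zero] at hwin; unfold s4 rzero b2 at hwin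
    have : 0 < Real.sqrt 3 := Real.sqrt_pos.2 (by norm_num); linarith
  by_cases hy : 2 * ρA < footY ρA (angleUp (rzero ε) ‖q.1‖)
  · -- the wall piece itself
    have hper : ∀ n ϑ (w : ℝ × ℝ), (fun p : ℝ × ℝ × ℝ × ℝ ↦ pieceU4 T.hε T.hε2 T.nj T.ρA (p.1, p.2.1, T.lam * p.2.2.1, T.lam * p.2.2.2)) (n, ϑ + 2 * π, w) =
        (fun p : ℝ × ℝ × ℝ × ℝ ↦ pieceU4 T.hε T.hε2 T.nj T.ρA (p.1, p.2.1, T.lam * p.2.2.1, T.lam * p.2.2.2)) (n, ϑ, w) :=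
      fun n ϑ w ↦ pieceU4_add_two_pi T.hε T.hε2 (n, ϑ, T.lam * w.1, T.lam * w.2)
    have hsin : Real.sin (angleUp (rzero ε) ‖q.1‖) ≠ 0 := (sin_alpha_pos hwin).ne'
    have hf := hasDerivAt_yF (ε := ε) hsin
    have hf' : 0 < ρA * (1 / Real.sin (angleUp (rzero ε) ‖q.1‖) ^ 2) * (3 / 2 * (1 / (1 + (‖q.1‖ - rzero ε) ^ 2))) := by
      have := ρA_pos; positivity
    have hposf : ∀ᶠ t in 𝓝 ‖q.1‖, ContDiffAt ℝ ∞ (yF ε) t := by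
      filter_upwards [Ioi_mem_nhds hwin] with t ht using contDiffAt_yF (sin_alpha_pos ht).ne'
    refine isLocalDiffeomorphAt_radialForm hper hd hposf (by
      show deriv (yF ε) ‖q.1‖ ≠ 0; rw [hf.deriv]; exact hf'.ne') ?_
    refine isLocalDiffeomorphAt_comp_scaleW hl0.ne' ?_
    have hla : |lam ε * q.2.1| < ρA := by
      rw [abs_mul, abs_of_pos hl0]; unfold ρA
      calc lam ε * |q.2.1| ≤ (1 / 10) * |q.2.1| := mul_le_mul_of_nonneg_right (by linarith) (abs_nonneg _)
        _ < 1 / 20 := by linarith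
    refine isLocalDiffeomorphAt_pieceU4 T.hε T.hε2 hy hla ?_
    have hn := norm_tubeUpMap_fst_le ρA_pos (footY ρA (angleUp (rzero ε) ‖q.1‖), arg q.1, lam ε * q.2.1, lam ε * q.2.2)
    have hlb : |lam ε * q.2.2| < 1 := by
      rw [abs_mul, abs_of_pos hl0]
      calc lam ε * |q.2.2| ≤ 1 * |q.2.2| := mul_le_mul_of_nonneg_right (by linarith) (abs_nonneg _)
        _ < 1 := by rw [one_mul]; linarith
    simp only at hn
    have hρA : (2 : ℝ) * ρA = 1 / 10 := by unfold ρA; norm_num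
    show ‖(tubeUpMap ρA (footY ρA (angleUp (rzero ε) ‖q.1‖), arg q.1, lam ε * q.2.1, lam ε * q.2.2)).1‖ < capTj ε (nj ε)
    unfold ρA at hla; linarith
  · -- on the foot of the collar: agree with U5 nearby
    rw [not_lt] at hy
    have hA3 : 0 < Real.arctan (1 / 3) := Real.arctan_pos.2 (by norm_num)
    have h34 : angleUp (rzero ε) ‖q.1‖ ≤ 3 * π / 4 := by
      by_contra hc
      rw [not_le] at hc
      have := footY_le_footY ρA_pos (by linarith [Real.pi_pos]) hc.le hαhi
      rw [footY_three_pi_div_four] at this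
      -- strictly: footY is strictly increasing
      have hst := strictMonoOn_footY ρA_pos ⟨by linarith [Real.pi_pos], by linarith [Real.pi_pos]⟩ ⟨by linarith, hαhi⟩ hc
      rw [footY_three_pi_div_four] at hst
      linarith
    have hU5 : IsLocalDiffeomorphAt 𝓘(ℝ, ℂ × ℝ × ℝ) 𝓘(ℝ, 𝔼 4) ∞ T.winU5 q :=
      ldU5_holds' hε2 hq hd (by linarith [Real.pi_pos]) (by
        have : Real.arctan (1 / 3) < π / 4 := by rw [← Real.arctan_one]; exact Real.arctan_strictMono (by norm_num)
        linarith)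
    refine isLocalDiffeomorphAt_congr_nhds' hU5 ?_
    -- the open agreement region `{s₄ - 1/10 < r} ∩ {footY ρ_A α < 11 ρ_A / 5}`
    set S : Set (ℂ × ℝ × ℝ) := {q' | s4 ε - 1 / 10 < ‖q'.1‖} with hS
    have hSo : IsOpen S := isOpen_lt continuous_const (continuous_norm.comp continuous_fst)
    have hcont : ContinuousOn (fun q' : ℂ × ℝ × ℝ ↦ yF ε ‖q'.1‖) S := fun q' hq' ↦
      (ContinuousAt.comp (f := fun q' : ℂ × ℝ × ℝ ↦ ‖q'.1‖) (x := q') (contDiffAt_yF (sin_alpha_pos hq').ne').continuousAt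
        (continuous_norm.comp continuous_fst).continuousAt).continuousWithinAt
    have hO : IsOpen (S ∩ (fun q' : ℂ × ℝ × ℝ ↦ yF ε ‖q'.1‖) ⁻¹' Iio (11 * ρA / 5)) := hcont.isOpen_inter_preimage hSo isOpen_Iio
    have hqO : q ∈ S ∩ (fun q' : ℂ × ℝ × ℝ ↦ yF ε ‖q'.1‖) ⁻¹' Iio (11 * ρA / 5) := by
      refine ⟨hwin, ?_⟩
      show footY ρA (angleUp (rzero ε) ‖q.1‖) < 11 * ρA / 5
      have := ρA_pos; linarith
    filter_upwards [hO.mem_nhds hqO] with q' hq'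
    have h1 : π / 3 < angleUp (rzero ε) ‖q'.1‖ := by linarith [alpha_gt_pi_div_two hq'.1, Real.pi_pos]
    have h2 : footY ρA (angleUp (rzero ε) ‖q'.1‖) ≤ 11 * ρA / 5 := le_of_lt hq'.2
    exact (T.agree₄ ρA_pos h1 h2).symm

include hε2 in
/-- `λ ρ_b S < r_sw` and `λ ρ_b S < r_vert`: the frame-scaled offsets stay inside the switch and
smallness radii of the cap chart. [folklore] -/
theorem lam_rhoB_S_lt :
    lam ε * rhoB ε hε hε2 * (vert ε hε hε2).S < capSwitchRad hε (nj_sq_lt ε hε) (nj_neg ε hε) ∧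
      lam ε * rhoB ε hε hε2 * (vert ε hε hε2).S < vertRad hε (nj_sq_lt ε hε) (nj_neg ε hε) := by
  obtain ⟨htj1, htj2⟩ := capTj_bounds ε hε
  have hl0 := lam_pos ε hε; have hl := lam_le ε hε
  have hρ0 := rhoB_pos hε hε2
  have hsw := rhoB_le_switch hε hε2; have hvr := rhoB_le_vert hε hε2
  have hsw0 := capSwitchRad_pos hε (nj_sq_lt ε hε) (nj_neg ε hε)
  have hvr0 := vertRad_pos hε (nj_sq_lt ε hε) (nj_neg ε hε)
  have hS : (vert ε hε hε2).S = max (sig1top ε) (sig2top ε) := rfl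
  -- `capCL ≥ ε / 12.6`
  have hcl : ε / (64 / 5) ≤ capCL ε (nj ε) := by
    rw [capCL]
    refine div_le_div_of_nonneg_left hε.le (by positivity) ?_
    have h1 : 1 + capTj ε (nj ε) ^ 2 < 541 / 100 := by nlinarith
    have h2 : Real.sqrt (1 + capTj ε (nj ε) ^ 2) < 233 / 100 := by
      rw [Real.sqrt_lt' (by norm_num)]; linarith
    have h3 : 0 < Real.sqrt (1 + capTj ε (nj ε) ^ 2) := Real.sqrt_pos.2 (by positivity)
    nlinarith
  have hcl0 := capCL_pos (nj := nj ε) hε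
  -- the two scalings
  have key : ∀ R : ℝ, 0 < R → rhoB ε hε hε2 ≤ ε * R / 13 → lam ε * rhoB ε hε hε2 * max (sig1top ε) (sig2top ε) < R := by
    intro R hR hle
    rcases le_total (sig1top ε) (sig2top ε) with hm | hm
    · rw [max_eq_right hm, sig2top, show lam ε * rhoB ε hε hε2 * (2 * π * capTj ε (nj ε) / lam ε) =
        2 * π * capTj ε (nj ε) * rhoB ε hε hε2 by field_simp]
      calc 2 * π * capTj ε (nj ε) * rhoB ε hε hε2 ≤ 2 * π * capTj ε (nj ε) * (ε * R / 13) :=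
            mul_le_mul_of_nonneg_left hle (by positivity)
        _ < R := by
            have : 2 * π * capTj ε (nj ε) * ε / 13 < 1 := by
              have h1 : 2 * π * capTj ε (nj ε) * ε ≤ 2 * π * (21 / 10) * (1 / 2) :=
                mul_le_mul (mul_le_mul_of_nonneg_left htj2.le (by positivity)) hε2 hε.le (by positivity)
              nlinarith [Real.pi_lt_d2]
            calc 2 * π * capTj ε (nj ε) * (ε * R / 13) = (2 * π * capTj ε (nj ε) * ε / 13) * R := by ring
              _ < 1 * R := mul_lt_mul_of_pos_right this hR
              _ = R := one_mul R
    · rw [max_eq_left hm, sig1top, show lam ε * rhoB ε hε hε2 * (1 / (lam ε * capCL ε (nj ε))) = rhoB ε hε hε2 / capCL ε (nj ε) by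
        field_simp]
      rw [div_lt_iff₀ hcl0]
      calc rhoB ε hε hε2 ≤ ε * R / 13 := hle
        _ < R * (ε / (64 / 5)) := by rw [show ε * R / 13 = R * (ε / 13) by ring]; exact mul_lt_mul_of_pos_left (by
            rw [div_lt_div_iff₀ (by norm_num) (by norm_num)]; linarith) hR
        _ ≤ R * capCL ε (nj ε) := mul_le_mul_of_nonneg_left hcl hR.le
  rw [hS]
  exact ⟨key _ hsw0 hsw, key _ hvr0 hvr⟩

include hε2 in
/-- **Window U3.** [folklore] -/
theorem ldU3_holds {q : ℂ × ℝ × ℝ} (hq : q.2 ∈ DiscP ε hε hε2) (h : (fishTgen ε hε hε2 c ρb μ).s₅ - eta ε < ‖q.1‖)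
    (h' : ‖q.1‖ < (fishTgen ε hε hε2 c ρb μ).s₆ + eta ε) :
    IsLocalDiffeomorphAt 𝓘(ℝ, ℂ × ℝ × ℝ) 𝓘(ℝ, 𝔼 4) ∞ (fishTgen ε hε hε2 c ρb μ).winU3 q := by
  set T := fishTgen ε hε hε2 c ρb μ with hT
  have es₅ : T.s₅ = s5 ε := rfl
  have es₆ : T.s₆ = s6 ε := rfl
  rw [es₅] at h; rw [es₆] at h'
  have hη := eta_lt hε hε2
  obtain ⟨hq1, hq2⟩ := sqrt_three_bounds
  obtain ⟨hi1, hi2⟩ := inv_sqrt_three_bounds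
  have hl := lam_le ε hε; have hl0 := lam_pos ε hε
  obtain ⟨hs, ha, hb⟩ := disc_bounds hε2 hq
  have hρ := rhoB_le hε hε2; have hρε := rhoB_le_eps hε hε2
  have hw1 : s4 ε - 1 / 10 < ‖q.1‖ := by unfold s5 at h; unfold s4; linarith
  have hw2 : ‖q.1‖ < rone ε + 1 / Real.sqrt 3 := by
    unfold s6 at h'
    have : 0 < 1 / Real.sqrt 3 := by positivity
    linarith
  have hd : q.1 ≠ 0 := fun h0 ↦ by
    rw [h0, norm_zero] at hw1; unfold s4 rzero b2 at hw1; linarith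
  have hper : ∀ n ϑ (w : ℝ × ℝ), (fun p : ℝ × ℝ × ℝ × ℝ ↦ pieceU3 T.hε T.hε2 T.nj T.V (p.1, p.2.1, T.lam * p.2.2.1, T.lam * p.2.2.2)) (n, ϑ + 2 * π, w) =
      (fun p : ℝ × ℝ × ℝ × ℝ ↦ pieceU3 T.hε T.hε2 T.nj T.V (p.1, p.2.1, T.lam * p.2.2.1, T.lam * p.2.2.2)) (n, ϑ, w) :=
    fun n ϑ w ↦ pieceU3_add_two_pi T.hε T.hε2 (n, ϑ, T.lam * w.1, T.lam * w.2)
  have hopen : IsOpen {t : ℝ | s4 ε - 1 / 10 < t ∧ t < rone ε + 1 / Real.sqrt 3} :=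
    (isOpen_lt continuous_const continuous_id).inter (isOpen_lt continuous_id continuous_const)
  have hposf : ∀ᶠ t in 𝓝 ‖q.1‖, ContDiffAt ℝ ∞ T.yfun t := by
    filter_upwards [hopen.mem_nhds ⟨hw1, hw2⟩] with t ht using (deriv_yfun_pos hε hε2 (c := c) (ρb := ρb) (μ := μ) ht.1 ht.2).2
  refine isLocalDiffeomorphAt_radialForm hper hd hposf (deriv_yfun_pos hε hε2 (c := c) (ρb := ρb) (μ := μ) hw1 hw2).1.ne' ?_
  refine isLocalDiffeomorphAt_comp_scaleW hl0.ne' ?_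
  -- the vertical piece at `(y, ℓ, λa, λb)`
  set y := T.yfun ‖q.1‖ with hy
  set w : ℂ := ((lam ε * q.2.1 : ℝ) : ℂ) + ((lam ε * q.2.2 : ℝ) : ℂ) * I with hw
  have hwn : ‖w‖ < lam ε * rhoB ε hε hε2 := by
    have : ‖w‖ = lam ε * Real.sqrt (q.2.1 ^ 2 + q.2.2 ^ 2) := by
      rw [hw, Complex.norm_def, Complex.normSq_apply]; simp
      rw [show lam ε * q.2.1 * (lam ε * q.2.1) + lam ε * q.2.2 * (lam ε * q.2.2) = lam ε ^ 2 * (q.2.1 ^ 2 + q.2.2 ^ 2) by ring,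
        Real.sqrt_mul (sq_nonneg _), Real.sqrt_sq hl0.le]
    rw [this]; exact mul_lt_mul_of_pos_left hs hl0
  obtain ⟨hS1, hS2⟩ := lam_rhoB_S_lt (hε := hε) hε2
  have hS0 : 0 < (vert ε hε hε2).S := lt_of_lt_of_le one_pos (vert ε hε hε2).one_le_S
  have hwS : ‖w‖ < capSwitchRad hε (nj_sq_lt ε hε) (nj_neg ε hε) / (vert ε hε hε2).S := by
    rw [lt_div_iff₀ hS0]; nlinarith
  -- the chart value is small
  set v := (vert ε hε hε2).frameL y (w * exp (arg q.1 * I)) with hv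
  have hvn : ‖v‖ < vertRad hε (nj_sq_lt ε hε) (nj_neg ε hε) := by
    have := norm_frameL_mul_exp_le (vert ε hε hε2) y (arg q.1) w
    nlinarith
  obtain ⟨hc1, hc2⟩ := vertRad_spec hε (nj_sq_lt ε hε) (nj_neg ε hε) ((vert ε hε hε2).m y) ((vert ε hε hε2).m_mem y) v hvn
  have hnj : nj ε = -(9 * ε / 10) := rfl
  have hcore : vertCore ε (nj ε) (vert ε hε hε2) y (arg q.1) w = ((nj ε, (3 : ℝ) / 4) : ℝ × ℝ) +
      capSwitchMap ε (nj ε) ((vert ε hε hε2).m y) v := rfl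
  have hc1' := abs_lt.1 hc1; have hc2' := abs_lt.1 hc2
  refine isLocalDiffeomorphAt_pieceU3 T.hε T.hε2 (nj_sq_lt ε hε) (nj_neg ε hε)
    (show ‖((lam ε * q.2.1 : ℝ) : ℂ) + ((lam ε * q.2.2 : ℝ) : ℂ) * I‖ < capSwitchRad hε (nj_sq_lt ε hε) (nj_neg ε hε) / (vert ε hε hε2).S by
      rw [← hw]; exact hwS) ?_ ?_ ?_ ?_
  all_goals simp only [Complex.ofReal_mul]
  all_goals rw [show ((lam ε : ℂ) * (q.2.1 : ℂ)) + (lam ε : ℂ) * (q.2.2 : ℂ) * I = w by rw [hw]; push_cast; ring]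
  · show 0 < 3 / 4 + (capSwitchMap ε (nj ε) ((vert ε hε hε2).m y) v).2; linarith
  · show 3 / 4 + (capSwitchMap ε (nj ε) ((vert ε hε hε2).m y) v).2 < 3 / 2; linarith
  · show nj ε + (capSwitchMap ε (nj ε) ((vert ε hε hε2).m y) v).1 ≠ 0; rw [hnj] at hc1' ⊢; linarith
  · show |nj ε + (capSwitchMap ε (nj ε) ((vert ε hε hε2).m y) v).1| < 2 * π
    rw [hnj] at hc1' ⊢; rw [abs_lt]; constructor <;> linarith [Real.pi_gt_three]

include hε2 in
/-- **Window U2.** [folklore] -/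
theorem ldU2_holds {q : ℂ × ℝ × ℝ} (hq : q.2 ∈ DiscP ε hε hε2) (h : (fishTgen ε hε hε2 c ρb μ).s₆ - eta ε < ‖q.1‖)
    (h' : ‖q.1‖ < (fishTgen ε hε hε2 c ρb μ).s₇ + eta ε) :
    IsLocalDiffeomorphAt 𝓘(ℝ, ℂ × ℝ × ℝ) 𝓘(ℝ, 𝔼 4) ∞ (fishTgen ε hε hε2 c ρb μ).winU2 q := by
  set T := fishTgen ε hε hε2 c ρb μ with hT
  have es₆ : T.s₆ = s6 ε := rfl
  have es₇ : T.s₇ = s7 ε := rfl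
  rw [es₆] at h; rw [es₇] at h'
  have hη := eta_lt hε hε2
  obtain ⟨hq1, hq2⟩ := sqrt_three_bounds
  obtain ⟨hs, ha, hb⟩ := disc_bounds hε2 hq
  have hρ := rhoB_le hε hε2; have hρε := rhoB_le_eps hε hε2
  obtain ⟨hβ1, hβ2⟩ := beta_winU2 (ε := ε) (r := ‖q.1‖) (by linarith) (by linarith)
  have hd : q.1 ≠ 0 := fun h0 ↦ by
    rw [h0, norm_zero] at h; unfold s6 rone rzero b2 at h; linarith
  have hper : ∀ n ϑ (w : ℝ × ℝ), pieceU2 T.hε T.hε2 T.nj T.R₀ T.yh T.t₀ (n, ϑ + 2 * π, w) = pieceU2 T.hε T.hε2 T.nj T.R₀ T.yh T.t₀ (n, ϑ, w) :=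
    fun n ϑ w ↦ pieceU2_add_two_pi T.hε T.hε2 (n, ϑ, w)
  have hder : deriv (angleDown (rone ε)) ‖q.1‖ ≠ 0 := by
    rw [(hasDerivAt_angleDown (rone ε) ‖q.1‖).deriv]
    have : 0 < 3 / 2 * (1 / (1 + (‖q.1‖ - rone ε) ^ 2)) := by positivity
    linarith
  refine isLocalDiffeomorphAt_radialForm hper hd (Eventually.of_forall fun t ↦ (contDiff_angleDown _).contDiffAt) hder ?_
  -- the path piece at `(β, ℓ, a, b)`
  obtain ⟨hr1, hr2⟩ := abs_rotAB_le (arg q.1) q.2.1 q.2.2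
  have hX := fst_pathShell_mem R0_pos (q := (angleDown (rone ε) ‖q.1‖, (rotAB (arg q.1) q.2.1 q.2.2).1)) hβ1.le
    (angleDown_mem _ _).2 (by show |(rotAB (arg q.1) q.2.1 q.2.2).1| < R0 / 2; unfold R0; linarith)
  have hnj : nj ε = -(9 * ε / 10) := rfl
  have ht₀ : T.t₀ = 3 / 4 - 2 * R0 := rfl
  refine isLocalDiffeomorphAt_pieceU2 T.hε T.hε2 R0_pos (jacRad_spec R0 R0_pos) hβ1.le hβ2
    (show |(rotAB (arg q.1) q.2.1 q.2.2).1| < jacRad R0 R0_pos by linarith [rhoB_le_jacR0 hε hε2, jacRad_pos R0 R0_pos]) ?_ ?_ ?_ ?_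
  · show 0 < T.t₀ + (pathShell R0 (angleDown (rone ε) ‖q.1‖, (rotAB (arg q.1) q.2.1 q.2.2).1)).1
    rw [ht₀]; unfold R0 at hX ⊢; linarith [hX.1]
  · show T.t₀ + (pathShell R0 (angleDown (rone ε) ‖q.1‖, (rotAB (arg q.1) q.2.1 q.2.2).1)).1 < 3 / 2
    rw [ht₀]; unfold R0 at hX ⊢; linarith [hX.2]
  · show nj ε + (rotAB (arg q.1) q.2.1 q.2.2).2 ≠ 0
    have := (abs_le.1 (hr2.trans hs.le))
    rw [hnj]; linarith [this.2]
  · show |nj ε + (rotAB (arg q.1) q.2.1 q.2.2).2| < 2 * π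
    have := (abs_le.1 (hr2.trans hs.le))
    rw [hnj, abs_lt]; constructor <;> linarith [Real.pi_gt_three]
set_option maxHeartbeats 400000 in -- buildfix (bf3-g27): 160k/180k FAIL, 200k PASS at accept time; line-neutral budget line
include hε2 in
/-- **Window U1.** [folklore] -/
theorem ldU1_holds {q : ℂ × ℝ × ℝ} (hq : q.2 ∈ AdmP ε hε hε2) (h : (fishT ε hε hε2).s₇ - eta ε < ‖q.1‖)
    (h' : ‖q.1‖ < rmaxP ε hε hε2) :
    IsLocalDiffeomorphAt 𝓘(ℝ, ℂ × ℝ × ℝ) 𝓘(ℝ, 𝔼 4) ∞ (fishT ε hε hε2).winU1 q := by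
  set T := fishT ε hε hε2 with hT
  have es₇ : T.s₇ = s7 ε := rfl
  rw [es₇] at h; rw [rmaxP_eq, cL_mul_rhoB] at h'
  have hη := eta_lt hε hε2
  have htan := tan_beta7_ge (ε := ε); have htan' := (tan_beta7_bounds ε).2
  obtain ⟨hq1, hq2⟩ := sqrt_three_bounds
  obtain ⟨hi1, hi2⟩ := inv_sqrt_three_bounds
  obtain ⟨hs, hpos, ha, hb, hlo⟩ := adm_bounds hε2 hq
  have hρ := rhoB_le hε hε2; have hρε := rhoB_le_eps hε hε2; have hρ0 := rhoB_pos hε hε2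
  have hw1 : s7 ε - 3 / 100 < ‖q.1‖ := by linarith
  have hw2 : ‖q.1‖ < s7 ε + 3 / 10 := by linarith
  have hd : q.1 ≠ 0 := fun h0 ↦ by rw [h0, norm_zero] at hw1; linarith [s7_gt ε hε]
  have hper : ∀ n ϑ (w : ℝ × ℝ), pieceU1 T.hε T.hε2 T.nj T.yh T.cL T.ρbL T.μL (n, ϑ + 2 * π, w) =
      pieceU1 T.hε T.hε2 T.nj T.yh T.cL T.ρbL T.μL (n, ϑ, w) := fun n ϑ w ↦ pieceU1_add_two_pi T.hε T.hε2 (n, ϑ, w)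
  have hposf : ∀ᶠ t in 𝓝 ‖q.1‖, ContDiffAt ℝ ∞ T.posL t := by
    filter_upwards [Ioi_mem_nhds hw1] with t ht using (deriv_posL_pos hε hε2 (c := cL ε hε hε2) (ρb := rhoB ε hε hε2) (μ := muL ε) (cL_mul_rhoB' ε hε hε2) ht).2
  refine isLocalDiffeomorphAt_radialForm hper hd hposf (deriv_posL_pos hε hε2 (c := cL ε hε hε2) (ρb := rhoB ε hε hε2) (μ := muL ε) (cL_mul_rhoB' ε hε hε2) hw1).1.ne' ?_
  -- the leg piece at `(posL r, ϑ, a, b)`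
  set r' := T.posL ‖q.1‖ with hr'
  set m := Real.sqrt (q.2.1 ^ 2 + q.2.2 ^ 2) with hm
  have hcρ := cL_mul_rhoB ε hε hε2
  have hc0 := cL_pos ε hε hε2
  -- range of the leg position
  have hβ : -(π / 4) < angleDown (rone ε) ‖q.1‖ ∧ angleDown (rone ε) ‖q.1‖ < 0 := by
    unfold s7 at hw1 hw2
    constructor
    · rw [← angleDown_add_sqrt_three (rone ε)]; exact strictAnti_angleDown _ (by linarith)
    · rw [← angleDown_add_inv_sqrt_three (rone ε)]; exact strictAnti_angleDown _ (by linarith)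
  have htβ : -1 < Real.tan (angleDown (rone ε) ‖q.1‖) ∧ Real.tan (angleDown (rone ε) ‖q.1‖) < 0 := by
    constructor
    · have := Real.tan_lt_tan_of_lt_of_lt_pi_div_two (by linarith [Real.pi_pos]) (by linarith [Real.pi_pos]) hβ.1
      rwa [Real.tan_neg, Real.tan_pi_div_four] at this
    · have := Real.tan_lt_tan_of_lt_of_lt_pi_div_two (by linarith [Real.pi_pos]) (by linarith [Real.pi_pos]) hβ.2
      rwa [Real.tan_zero] at this
  have hr'mem : cL ε hε hε2 * rhoB ε hε hε2 - 1 / 4 < r' ∧ r' < cL ε hε hε2 * rhoB ε hε hε2 + 3 / 4 := by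
    have hf : T.rL (angleDown (rone ε) ‖q.1‖) = cL ε hε hε2 * rhoB ε hε hε2 - 1 / 4 - Real.tan (angleDown (rone ε) ‖q.1‖) := rL_eq hε hε2 _
    rw [hr', show T.posL = blendFun (stdBlend (a8 ε) (b8 ε)) (fun r ↦ T.rL (angleDown (rone ε) r)) fun r ↦ r from rfl, blendFun, hf]
    have hχ := stdBlend_mem (a8 ε) (b8 ε) ‖q.1‖
    have hfm : cL ε hε hε2 * rhoB ε hε hε2 - 1 / 4 - Real.tan (angleDown (rone ε) ‖q.1‖) ∈
        Ioo (cL ε hε hε2 * rhoB ε hε hε2 - 1 / 4) (cL ε hε hε2 * rhoB ε hε hε2 + 3 / 4) := ⟨by linarith, by linarith⟩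
    have hrm : ‖q.1‖ ∈ Ioo (cL ε hε hε2 * rhoB ε hε hε2 - 1 / 4) (cL ε hε hε2 * rhoB ε hε hε2 + 3 / 4) := ⟨by linarith, by linarith⟩
    exact convex_combo_mem_Ioo hχ.1 hχ.2 hfm hrm
  have hμ01 := stdBlend_mem (s7 ε + 1 / 25) (s7 ε + 7 / 100) r'
  have hE := E1_le'; have hE0 := E1_pos; have hC := C0_pos
  have hm0 : 0 < rhoB ε hε hε2 - m ∧ rhoB ε hε hε2 - m < E1 / cL ε hε hε2 := ⟨by linarith, by linarith⟩
  refine isLocalDiffeomorphAt_pieceU1 T.hε T.hε2 (contDiff_stdBlend _ _) (show q.2.1 ^ 2 + q.2.2 ^ 2 ≠ 0 from hpos.ne') ?_ ?_ ?_ ?_ ?_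
  · -- the Jacobian factor
    show bxH * (1 + 2 * cL ε hε hε2 * (rhoB ε hε hε2 - Real.sqrt (q.2.1 ^ 2 + q.2.2 ^ 2)) * deriv (muL ε) r') ≠ 0
    rw [← hm]
    have hμ' : |deriv (muL ε) r'| ≤ C0 / (3 / 100) := by
      have := abs_deriv_stdBlend_le (a := s7 ε + 1 / 25) (b := s7 ε + 7 / 100) (by linarith) r'
      rwa [show s7 ε + 7 / 100 - (s7 ε + 1 / 25) = 3 / 100 by ring] at this
    have h2E : 2 * cL ε hε hε2 * (rhoB ε hε hε2 - m) < 2 * E1 := by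
      have := mul_lt_mul_of_pos_left hm0.2 hc0
      rw [mul_div_cancel₀ _ hc0.ne'] at this; linarith
    have hP0 : 0 < 2 * cL ε hε hε2 * (rhoB ε hε hε2 - m) := mul_pos (mul_pos two_pos hc0) hm0.1
    have hsmall : |2 * cL ε hε hε2 * (rhoB ε hε hε2 - m) * deriv (muL ε) r'| < 2 / 3 := by
      rw [abs_mul, abs_of_pos hP0]
      have hq : C0 / (C0 + 1) < 1 := by rw [div_lt_one (by linarith)]; linarith
      calc 2 * cL ε hε hε2 * (rhoB ε hε hε2 - m) * |deriv (muL ε) r'| ≤ 2 * E1 * (C0 / (3 / 100)) :=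
            mul_le_mul h2E.le hμ' (abs_nonneg _) (by linarith)
        _ = 200 / 3 * E1 * C0 := by ring
        _ ≤ 200 / 3 * (1 / (100 * (C0 + 1))) * C0 := mul_le_mul_of_nonneg_right (mul_le_mul_of_nonneg_left hE (by norm_num)) hC.le
        _ = (2 / 3) * (C0 / (C0 + 1)) := by field_simp; ring
        _ < 2 / 3 := by linarith
    have := neg_abs_le (2 * cL ε hε hε2 * (rhoB ε hε hε2 - m) * deriv (muL ε) r')
    rw [bxH]; apply mul_ne_zero (by norm_num); linarith
  · show 0 < legT (muL ε) (cL ε hε hε2) (rhoB ε hε hε2) r' (Real.sqrt (q.2.1 ^ 2 + q.2.2 ^ 2))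
    rw [← hm, legT, bxH]
    have hP0 : 0 < 2 * cL ε hε hε2 * (rhoB ε hε hε2 - m) := mul_pos (mul_pos two_pos hc0) hm0.1
    have h1 : 0 ≤ 2 * cL ε hε hε2 * (rhoB ε hε hε2 - m) * muL ε r' := mul_nonneg hP0.le hμ01.1
    linarith [hr'mem.1]
  · show legT (muL ε) (cL ε hε hε2) (rhoB ε hε hε2) r' (Real.sqrt (q.2.1 ^ 2 + q.2.2 ^ 2)) < 3 / 2
    rw [← hm, legT, bxH]
    have hP0 : 0 < 2 * cL ε hε hε2 * (rhoB ε hε hε2 - m) := mul_pos (mul_pos two_pos hc0) hm0.1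
    have h2E : 2 * cL ε hε hε2 * (rhoB ε hε hε2 - m) < 2 * E1 := by
      have := mul_lt_mul_of_pos_left hm0.2 hc0
      rw [mul_div_cancel₀ _ hc0.ne'] at this; linarith
    have h1 : 2 * cL ε hε hε2 * (rhoB ε hε hε2 - m) * muL ε r' ≤ 2 * E1 := by
      calc 2 * cL ε hε hε2 * (rhoB ε hε hε2 - m) * muL ε r' ≤ 2 * cL ε hε hε2 * (rhoB ε hε hε2 - m) * 1 :=
            mul_le_mul_of_nonneg_left hμ01.2 hP0.le
        _ ≤ 2 * E1 := by linarith
    have := E1_le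
    linarith [hr'mem.2]
  · show nj ε + (exp (arg q.1 * I) * (q.2.1 + q.2.2 * I)).re ≠ 0
    have := (abs_le.1 ((abs_re_im_rot_le (arg q.1) q.2.1 q.2.2).1.trans hs.le)).2
    have hnj : nj ε = -(9 * ε / 10) := rfl
    rw [hnj]; linarith
  · show |nj ε + (exp (arg q.1 * I) * (q.2.1 + q.2.2 * I)).re| < 2 * π
    have := abs_le.1 ((abs_re_im_rot_le (arg q.1) q.2.1 q.2.2).1.trans hs.le)
    have hnj : nj ε = -(9 * ε / 10) := rfl
    rw [hnj, abs_lt]; constructor <;> linarith [Real.pi_gt_three]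

end Windows

/-! ### The glue hypotheses -/

variable (hε)

include hε2 in
/-- **The glue hypotheses hold for the concrete data.** [folklore] -/
theorem glueHyp : (fishT ε hε hε2).GlueHyp (eta ε) (rmaxP ε hε hε2) (AdmP ε hε hε2) := by
  set T := fishT ε hε hε2 with hT
  have hη0 := eta_pos ε hε
  have hη := eta_lt hε hε2
  obtain ⟨hs21, hs22⟩ := s2_bounds hε hε2
  obtain ⟨hi1, hi2⟩ := inv_sqrt_three_bounds
  obtain ⟨hq1, hq2⟩ := sqrt_three_bounds
  obtain ⟨htj1, htj2⟩ := capTj_bounds ε hε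
  have hr0 : rzero ε = 12 + ε / 100 := by unfold rzero b2; ring
  have hρb := rhoB_pos hε hε2
  have hρbε := rhoB_le_eps hε hε2
  -- unfolding of the data
  have eε : T.ε = ε := rfl
  have enj : T.nj = nj ε := rfl
  have es₁ : T.s₁ = 3 / 4 := rfl
  have es₂ : T.s₂ = s2 ε := rfl
  have es₃ : T.s₃ = s3 ε := rfl
  have es₄ : T.s₄ = s4 ε := rfl
  have es₅ : T.s₅ = s5 ε := rfl
  have es₆ : T.s₆ = s6 ε := rfl
  have es₇ : T.s₇ = s7 ε := rfl
  refine
    { hη := hη0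
      hAdm := isOpen_AdmP hε hε2
      h01 := by rw [es₁]; linarith
      h12 := by rw [es₁, es₂]; linarith
      h23 := by rw [es₂, es₃]; unfold s3; linarith
      h34 := by rw [es₃, es₄]; unfold s3 s4; linarith
      h45 := by rw [es₄, es₅]; unfold s4 s5; linarith
      h56 := by rw [es₅, es₆]; unfold s5 s6 rone; linarith
      h67 := by
        rw [es₆, es₇]; unfold s6 s7
        have : 0 < 1 / Real.sqrt 3 := by positivity
        linarith
      h7 := by
        rw [es₇, rmaxP_eq, cL_mul_rhoB]
        have := tan_beta7_ge (ε := ε); linarith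
      ag₁ := fun q _ h ↦ ag1_holds hε2 h
      ag₂ := fun q _ h ↦ ag2_holds hε2 h
      ag₃ := fun q _ h ↦ ag3_holds hε2 h
      ag₄ := fun q _ h ↦ ag4_holds hε2 h
      ag₅ := fun q _ h ↦ ag5_holds hε2 h
      ag₆ := fun q _ h ↦ ag6_holds hε2 h
      ag₇ := fun q _ h ↦ ag7_holds hε2 (cL_mul_rhoB' ε hε hε2) (fun r hr ↦ muL_of_le hr) h
      ldS := fun q hq h ↦ ldS_holds hε2 (AdmP_subset_DiscP hε2 hq) h
      ldA := fun q hq h h' ↦ ldA_holds hε2 (AdmP_subset_DiscP hε2 hq) h h'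
      ldN := fun q hq h h' ↦ ldN_holds hε2 (AdmP_subset_DiscP hε2 hq) h h'
      ldU5 := fun q hq h h' ↦ ldU5_holds hε2 (AdmP_subset_DiscP hε2 hq) h h'
      ldU4 := fun q hq h h' ↦ ldU4_holds hε2 (AdmP_subset_DiscP hε2 hq) h h'
      ldU3 := fun q hq h h' ↦ ldU3_holds hε2 (AdmP_subset_DiscP hε2 hq) h h'
      ldU2 := fun q hq h h' ↦ ldU2_holds hε2 (AdmP_subset_DiscP hε2 hq) h h'
      ldU1 := fun q hq h h' ↦ ldU1_holds hε2 hq h h' }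

end FP

end Literature.Topology.FourManifolds
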